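import Summits.QuantumFields.YangMills.Theorems.IR.LargeFieldRarityDefs

/-!
# Large-field rarity package, file 3∕5: (FE∞)+(FS) ⇒ (FE), plaquette-cost lemmas, (FE) ⇒ (EM), and (FE)+(FE<) ⇒ (FE) at floor 0 — PROVED

Landed for item `stmt-QuantumFields-19354` (`--supports … --as helper`) by the LEAD prover ab-p1 under director-ym RULING g9-№2 ∕ №14 (3)
(critic ym-ir-crit-1 GATE 2026-08-28T03:18:39Z: supplier PROVED, land under `Theorems/IR/`); authored by ideator ym-ir-idea-4 g3, split of the
sorry-free workfile `Cruxes/IR/Lines/largefield_rarity_chessboard.lean` v8 per `Cruxes/IR/Lines/largefield_rarity_chessboard_LANDING.md`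
(five files: `LargeFieldRarityDefs` → {`…FiniteSize`, `…Increment`} → `…Engine` → `…OddTori`).

Content: `freeEnergyIncrement_of_thermo : FreeEnergyThermo → FiniteSizeFreeEnergy → FreeEnergyIncrement` (§2), the elementary cost lemmas
`plaqCost_nonneg` ∕ `plaqCost_le` ∕ `sum_plaqCost_le_wilsonAction` ∕ `measurable_plaqCost` ∕ `plaqCost_eq_plaquetteCost` (§3),
`expMomentBound_of_increment : FreeEnergyIncrementFrom fl → ExpMomentBoundFrom fl` (§4, `λ = 1/2`), and
`freeEnergyIncrementFrom_zero_of_below : FreeEnergyIncrement → FreeEnergyIncrementBelow → FreeEnergyIncrementFrom 0` (§8).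

HONESTY.  Nothing here proves the Clay Yang–Mills mass gap, a lattice mass gap, `BalabanLadder.IR`, (T) or (M-b); R4 of the
ladder closes only the conditional finite-𝕋⁴ rung `BalabanLadder.UV`.
-/

noncomputable section

open MeasureTheory Finset
open Literature.MathematicalPhysics.QuantumFieldTheory Literature.MathematicalPhysics.QuantumLattice
open Summit.QuantumFields.YangMills.Theorems (OddTorusChessboard.Orient OddTorusChessboard.wilsonExpectation_expObs_le_exp_card_all
  SoloBlind.expObs)

namespace Summit.QuantumFields.YangMills.Cruxes.IR.LargeFieldRarityChessboard

/-! ## §2 SEAM 0 (proved): (FE∞) + (FS) ⇒ (FE) -/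

/-- **(FE∞) + (FS) ⇒ (FE)** with `ν₀ = ν`, `C = 2 + 4C_FS`, `m(β) = ⌈β⌉₊ + 2`, floor `L₀(β) = m(β)²`: the two finite-size errors
are `≤ 2C_FS L⁴` each since `(1+β)/m ≤ 1` and `(1+β)m ≤ m² ≤ L`, and `f(β') − f(β) ≤ ν log(β/β') + 2`. -/
theorem freeEnergyIncrement_of_thermo (hT : FreeEnergyThermo) (hS : FiniteSizeFreeEnergy) : FreeEnergyIncrement := by
  intro G _ _ _ _ hG
  letI : MeasurableSpace G := borel G
  haveI : BorelSpace G := ⟨rfl⟩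
  intro r
  obtain ⟨ν, K, β₃, hβ₃, hth⟩ := hT G hG r
  obtain ⟨C, hC0, hfs⟩ := hS G r
  refine ⟨ν, 2 + 4 * C, β₃, hβ₃, ?_⟩
  intro L _ β' β hβ' hβ'β hL
  set m : ℕ := ⌈β⌉₊ + 2 with hm
  have hm2 : 2 ≤ m := by omega
  have hmL : m * m ≤ L := hL
  have hβ'pos : 0 < β' := lt_of_lt_of_le hβ₃ hβ'
  have hβpos : 0 < β := lt_of_lt_of_le hβ'pos hβ'β
  have h1 := hth β' hβ'
  have h2 := hth β (hβ'.trans hβ'β)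
  have e1 := hfs β' L m hm2 hmL
  have e2 := hfs β L m hm2 hmL
  have hmβ : β + 1 ≤ (m : ℝ) := by
    have := Nat.le_ceil β
    rw [hm]; push_cast; linarith
  have hmR : (0 : ℝ) < m := by positivity
  have hLR : (m : ℝ) * m ≤ L := by exact_mod_cast hmL
  have hL4 : (0 : ℝ) ≤ (L : ℝ) ^ 4 := by positivity
  have key : ∀ b : ℝ, 0 ≤ b → b ≤ β → (1 + |b|) * ((L : ℝ) ^ 4 / m + (L : ℝ) ^ 3 * m) ≤ 2 * (L : ℝ) ^ 4 := by
    intro b hb0 hb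
    rw [abs_of_nonneg hb0]
    have hb1 : 1 + b ≤ m := by linarith
    have t1 : (1 + b) * ((L : ℝ) ^ 4 / m) ≤ (L : ℝ) ^ 4 :=
      calc (1 + b) * ((L : ℝ) ^ 4 / m) = (1 + b) * (L : ℝ) ^ 4 / m := by ring
        _ ≤ (m : ℝ) * (L : ℝ) ^ 4 / m := by gcongr
        _ = (L : ℝ) ^ 4 := mul_div_cancel_left₀ _ hmR.ne'
    have t2 : (1 + b) * ((L : ℝ) ^ 3 * m) ≤ (L : ℝ) ^ 4 := by
      have h : (1 + b) * (m : ℝ) ≤ L := le_trans (mul_le_mul_of_nonneg_right hb1 hmR.le) hLR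
      calc (1 + b) * ((L : ℝ) ^ 3 * m) = ((1 + b) * m) * (L : ℝ) ^ 3 := by ring
        _ ≤ (L : ℝ) * (L : ℝ) ^ 3 := mul_le_mul_of_nonneg_right h (by positivity)
        _ = (L : ℝ) ^ 4 := by ring
    calc (1 + b) * ((L : ℝ) ^ 4 / m + (L : ℝ) ^ 3 * m)
        = (1 + b) * ((L : ℝ) ^ 4 / m) + (1 + b) * ((L : ℝ) ^ 3 * m) := by ring
      _ ≤ (L : ℝ) ^ 4 + (L : ℝ) ^ 4 := add_le_add t1 t2
      _ = 2 * (L : ℝ) ^ 4 := by ring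
  have E1 : |torusLogPartition 4 r.ρ β' L - (L : ℝ) ^ 4 * freeEnergyDensity 4 r.ρ β'| ≤ C * (2 * (L : ℝ) ^ 4) := by
    refine e1.trans ?_
    rw [mul_assoc]
    exact mul_le_mul_of_nonneg_left (key β' hβ'pos.le hβ'β) hC0
  have E2 : |torusLogPartition 4 r.ρ β L - (L : ℝ) ^ 4 * freeEnergyDensity 4 r.ρ β| ≤ C * (2 * (L : ℝ) ^ 4) := by
    refine e2.trans ?_
    rw [mul_assoc]
    exact mul_le_mul_of_nonneg_left (key β hβpos.le le_rfl) hC0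
  rw [abs_le] at h1 h2 E1 E2
  rw [Real.log_div hβpos.ne' hβ'pos.ne']
  have hf : (L : ℝ) ^ 4 * (freeEnergyDensity 4 r.ρ β' - freeEnergyDensity 4 r.ρ β) ≤
      (L : ℝ) ^ 4 * (ν * (Real.log β - Real.log β') + 2) :=
    mul_le_mul_of_nonneg_left (by linarith [h1.2, h2.1]) hL4
  linarith [hf, E1.2, E2.1]

/-! ## §3 Elementary facts about the plaquette cost -/

section Cost

variable {G : Type} [Group G] [TopologicalSpace G] [IsTopologicalGroup G] [CompactSpace G]
  [MeasurableSpace G] [BorelSpace G]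

omit [MeasurableSpace G] [BorelSpace G] in
/-- `0 ≤ s_p` (unitary-trick bound `|Re tr ρ| ≤ N`). -/
theorem plaqCost_nonneg (r : LatticeRep G) {L : ℕ} (U : GaugeConfig 4 L G)
    (p : Literature.MathematicalPhysics.QuantumFieldTheory.Plaquette 4 L) : 0 ≤ plaqCost r.ρ U p := by
  unfold plaqCost
  have h := Literature.RepresentationTheory.CompactGroups.CompactGroup.abs_re_trace_le_card r.ρ r.continuous
    (plaquetteHolonomy U p.1 p.2.1.1 p.2.1.2)
  rw [Fintype.card_fin] at h
  linarith [(abs_le.1 h).2]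

omit [MeasurableSpace G] [BorelSpace G] in
/-- `s_p ≤ 2N`. -/
theorem plaqCost_le (r : LatticeRep G) {L : ℕ} (U : GaugeConfig 4 L G)
    (p : Literature.MathematicalPhysics.QuantumFieldTheory.Plaquette 4 L) : plaqCost r.ρ U p ≤ 2 * r.N := by
  unfold plaqCost
  have h := Literature.RepresentationTheory.CompactGroups.CompactGroup.abs_re_trace_le_card r.ρ r.continuous
    (plaquetteHolonomy U p.1 p.2.1.1 p.2.1.2)
  rw [Fintype.card_fin] at h
  linarith [(abs_le.1 h).1]

omit [MeasurableSpace G] [BorelSpace G] in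
/-- `Σ_{p ∈ F} s_p ≤ S(U)` (all costs are non-negative). -/
theorem sum_plaqCost_le_wilsonAction (r : LatticeRep G) {L : ℕ} [NeZero L] (U : GaugeConfig 4 L G)
    (F : Finset (Literature.MathematicalPhysics.QuantumFieldTheory.Plaquette 4 L)) :
    ∑ p ∈ F, plaqCost r.ρ U p ≤ wilsonAction r.ρ U := by
  unfold wilsonAction
  calc ∑ p ∈ F, plaqCost r.ρ U p ≤ ∑ p, plaqCost r.ρ U p :=
        Finset.sum_le_univ_sum_of_nonneg fun p => plaqCost_nonneg r U p
    _ = _ := rfl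

/-- Measurability of `U ↦ s_p(U)` (second countability of `G` from the faithful representation). -/
theorem measurable_plaqCost (r : LatticeRep G) {L : ℕ}
    (p : Literature.MathematicalPhysics.QuantumFieldTheory.Plaquette 4 L) :
    Measurable fun U : GaugeConfig 4 L G => plaqCost r.ρ U p := by
  haveI : SecondCountableTopology G :=
    (r.continuous.isClosedEmbedding r.injective).isEmbedding.secondCountableTopology
  have hcont : Continuous fun g : G => ((r.ρ g).trace).re :=
    Complex.continuous_re.comp r.continuous.matrix_trace
  unfold plaqCost
  exact measurable_const.sub (hcont.measurable.comp (measurable_plaquetteHolonomy _ _ _))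

omit [TopologicalSpace G] [IsTopologicalGroup G] [CompactSpace G] [MeasurableSpace G] in
/-- `plaqCost` is the Literature's `plaquetteCost` (and LINE 3's `plaqCost`, and `SoloBlind.plaquetteCost`) — all `rfl`. -/
theorem plaqCost_eq_plaquetteCost {N L : ℕ} (ρ : G →* Matrix (Fin N) (Fin N) ℂ) (U : GaugeConfig 4 L G)
    (p : Literature.MathematicalPhysics.QuantumFieldTheory.Plaquette 4 L) :
    plaqCost ρ U p = plaquetteCost ρ U p := rfl

end Cost

/-! ## §4 SEAM 1 (proved): (FE) ⇒ (EM) -/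

/-- **(FE) ⇒ (EM)** with `λ = 1/2`: `∏_{p∈F} e^{β s_p/2} ≤ e^{β S/2}` pointwise, `⟨e^{βS/2}⟩_β = Z(β/2)/Z(β)`, and the
free-energy increment at `β' = β/2`. -/
theorem expMomentBound_of_increment {fl : ℝ → ℕ} (hFE : FreeEnergyIncrementFrom fl) : ExpMomentBoundFrom fl := by
  intro G _ _ _ _ hG
  letI : MeasurableSpace G := borel G
  haveI : BorelSpace G := ⟨rfl⟩
  intro r
  obtain ⟨ν₀, C, β₃, hβ₃, hinc⟩ := hFE G hG r
  refine ⟨1 / 2, ν₀ * Real.log 2 + C, 2 * β₃, by norm_num, by linarith, ?_⟩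
  intro L _ β hβ hL F
  haveI := isProbabilityMeasure_wilsonMeasure (d := 4) (L := L) (G := G) r.ρ r.continuous β
  have hβpos : 0 < β := by linarith
  -- the product Haar measure and the Boltzmann integrals
  set π₀ : Measure (GaugeConfig 4 L G) :=
    Measure.pi fun _ : Literature.MathematicalPhysics.QuantumFieldTheory.Edge 4 L => haarProbability G with hπ₀
  set Z : ℝ → ℝ := fun b => ∫ U, Real.exp (-b * wilsonAction r.ρ U) ∂π₀ with hZ
  have hZpos : ∀ b, 0 < Z b := fun b => integral_exp_neg_mul_wilsonAction_pos r.ρ r.continuous b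
  -- Step 1: pointwise domination by `exp(β S / 2)`
  have hdom : ∀ U : GaugeConfig 4 L G,
      ∏ p ∈ F, Real.exp (1 / 2 * β * plaqCost r.ρ U p) ≤ Real.exp ((β - β / 2) * wilsonAction r.ρ U) := by
    intro U
    rw [← Real.exp_sum]
    refine Real.exp_le_exp.2 ?_
    rw [← Finset.mul_sum]
    have hs := sum_plaqCost_le_wilsonAction r U F
    have : (β - β / 2) = 1 / 2 * β := by ring
    rw [this]
    exact mul_le_mul_of_nonneg_left hs (by positivity)
  have hnn : 0 ≤ᵐ[wilsonMeasure (d := 4) (L := L) r.ρ β]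
      fun U => ∏ p ∈ F, Real.exp (1 / 2 * β * plaqCost r.ρ U p) :=
    ae_of_all _ fun U => Finset.prod_nonneg fun p _ => (Real.exp_pos _).le
  have hint : Integrable (fun U => Real.exp ((β - β / 2) * wilsonAction r.ρ U))
      (wilsonMeasure (d := 4) (L := L) r.ρ β) :=
    integrable_exp_mul_wilsonAction r.ρ r.continuous _ _
  have h1 : ∫ U, ∏ p ∈ F, Real.exp (1 / 2 * β * plaqCost r.ρ U p) ∂(wilsonMeasure (d := 4) (L := L) r.ρ β) ≤
      ∫ U, Real.exp ((β - β / 2) * wilsonAction r.ρ U) ∂(wilsonMeasure (d := 4) (L := L) r.ρ β) :=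
    integral_mono_of_nonneg hnn hint (ae_of_all _ hdom)
  -- Step 2: the Gibbs identity `⟨e^{(β-β')S}⟩_β = Z(β')/Z(β)` with `β' = β/2`
  have hR : ∫ U, Real.exp ((β - β / 2) * wilsonAction r.ρ U) ∂(wilsonMeasure (d := 4) (L := L) r.ρ β) =
      Z (β / 2) / Z β := by
    have h := wilsonExpectation_eq_integral_div (d := 4) (L := L) r.ρ r.continuous β
      (fun U => Real.exp ((β - β / 2) * wilsonAction r.ρ U))
    unfold wilsonExpectation at h
    rw [h]
    congr 1
    refine integral_congr_ae (ae_of_all _ fun U => ?_)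
    beta_reduce
    rw [← Real.exp_add]
    congr 1
    ring
  -- Step 3: the increment bound
  have hψ : Real.log (Z (β / 2)) - Real.log (Z β) ≤ ν₀ * (L : ℝ) ^ 4 * Real.log 2 + C * (L : ℝ) ^ 4 := by
    have h := hinc L (β / 2) β (by linarith) (by linarith) hL
    rw [torusLogPartition_eq_log_integral r.ρ r.continuous, torusLogPartition_eq_log_integral r.ρ r.continuous] at h
    have hdiv : β / (β / 2) = 2 := by field_simp
    rw [hdiv] at h
    exact h
  have h2 : Z (β / 2) / Z β ≤ Real.exp ((ν₀ * Real.log 2 + C) * (L : ℝ) ^ 4) := by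
    have hq : 0 < Z (β / 2) / Z β := div_pos (hZpos _) (hZpos _)
    rw [← Real.exp_log hq, Real.exp_le_exp, Real.log_div (hZpos _).ne' (hZpos _).ne']
    linarith
  calc ∫ U, ∏ p ∈ F, Real.exp (1 / 2 * β * plaqCost r.ρ U p) ∂(wilsonMeasure (d := 4) (L := L) r.ρ β)
      ≤ ∫ U, Real.exp ((β - β / 2) * wilsonAction r.ρ U) ∂(wilsonMeasure (d := 4) (L := L) r.ρ β) := h1
    _ = Z (β / 2) / Z β := hR
    _ ≤ Real.exp ((ν₀ * Real.log 2 + C) * (L : ℝ) ^ 4) := h2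

/-! ## §8 (FE above the floor) + (FE<) ⇒ (FE) on ALL tori -/

/-- **(FE above the floor) + (FE<) ⇒ (FE) on ALL tori** (floor `0`; constants merged by `max`). -/
theorem freeEnergyIncrementFrom_zero_of_below (hFE : FreeEnergyIncrement) (hB : FreeEnergyIncrementBelow) :
    FreeEnergyIncrementFrom (fun _ => 0) := by
  intro G _ _ _ _ hG
  letI : MeasurableSpace G := borel G
  haveI : BorelSpace G := ⟨rfl⟩
  intro r
  obtain ⟨ν₁, C₁, β₁, hβ₁, h₁⟩ := (hFE : FreeEnergyIncrementFrom volFloor) G hG r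
  obtain ⟨ν₂, C₂, β₂, hβ₂, h₂⟩ := hB G hG r
  refine ⟨max ν₁ ν₂, max C₁ C₂, max β₁ β₂, lt_of_lt_of_le hβ₁ (le_max_left _ _), ?_⟩
  intro L _ β' β hβ' hβ'β _
  have hβ'pos : 0 < β' := lt_of_lt_of_le (lt_of_lt_of_le hβ₁ (le_max_left _ _)) hβ'
  have hlog : 0 ≤ Real.log (β / β') := Real.log_nonneg ((one_le_div hβ'pos).2 hβ'β)
  have hL4 : (0 : ℝ) ≤ (L : ℝ) ^ 4 := by positivity
  have mono : ∀ ν C : ℝ, ν ≤ max ν₁ ν₂ → C ≤ max C₁ C₂ →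
      ν * (L : ℝ) ^ 4 * Real.log (β / β') + C * (L : ℝ) ^ 4 ≤
        max ν₁ ν₂ * (L : ℝ) ^ 4 * Real.log (β / β') + max C₁ C₂ * (L : ℝ) ^ 4 := by
    intro ν C hν hC
    have t1 : ν * (L : ℝ) ^ 4 * Real.log (β / β') ≤ max ν₁ ν₂ * (L : ℝ) ^ 4 * Real.log (β / β') :=
      mul_le_mul_of_nonneg_right (mul_le_mul_of_nonneg_right hν hL4) hlog
    have t2 : C * (L : ℝ) ^ 4 ≤ max C₁ C₂ * (L : ℝ) ^ 4 := mul_le_mul_of_nonneg_right hC hL4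
    linarith
  by_cases hfl : volFloor β ≤ L
  · exact le_trans (h₁ L β' β (le_trans (le_max_left _ _) hβ') hβ'β hfl) (mono ν₁ C₁ (le_max_left _ _) (le_max_left _ _))
  · exact le_trans (h₂ L β' β (le_trans (le_max_right _ _) hβ') hβ'β (lt_of_not_ge hfl))
      (mono ν₂ C₂ (le_max_right _ _) (le_max_right _ _))

end Summit.QuantumFields.YangMills.Cruxes.IR.LargeFieldRarityChessboard

end
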